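import Literature.IUT.HodgeTheaters.GlobalFrobenioidsCoricRigidityOfDivisors
import HarnessLib

/-!
# [IUTchI] Example 5.1 (v), p. 127 l. 76 – p. 128 l. 24: "unique up to a uniquely determined isomorphism"
# for the model ∞κ-pair WITHOUT the identification `𝕄^⊛_κ = (𝕄^⊛_∞κ)^{π₁^rat}` as an input
# (proof-only; the divisor laws phrased on the `π₁^rat`-FIXED ∞κ-coric functions)

S. Mochizuki, *Inter-universal Teichmüller theory I*, kurims manuscript (May 2020), §5 Example 5.1 (v), p. 127
l. 76 – p. 128 l. 2: "the natural isomorphism … [is obtained] by considering divisors of zeroes and poles [cf.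
the definition of a '`κ`-coric function' given in Remark 3.1.7, (i)] associated to Kummer classes of rational
functions as in [AbsTopIII], Proposition 1.6, (iii)", and p. 128 l. 49–54 "`†ℱ^⊛` always admits an ∞κ-coric
(respectively, ∞κ×-coric) structure, which is, moreover, unique up to a uniquely determined isomorphism"
([IUTchI] Ex 5.1 (v) pp.127–128) [claim: Mochizuki2012, status: disputed] (D-0012 claim key; nothing disputed is
asserted here and no side is taken on [IUTchIII] Cor. 3.12).

Cell abc-iut, sub-DAG `plan/L5/SUBDAG-IUTchI-Ex51.md` row E51/L29 (∞κ case); LAYER-5 certificate row 1116 conjunct 1.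
abc-iut-w4-d056's closer of record `NFBridgeRecon.existsUniqueCoricStructure_infκPair_of_divisors` (p424116) reads
the divisor laws (b′) and Remark 3.1.7 (i) on the `κ`-CORIC functions `𝕄^⊛_κ(†𝒟^⊚)` and therefore consumes the
interface identification `NFBridgeRecon.MκIsInvariants` (FACT-LIST F-2571, "`𝕄^⊛_κ` = the `π₁^rat`-invariants of
`𝕄^⊛_∞κ`") to reach the `π₁^rat`-invariant sub-pseudo-monoid on which its engine `CoricPair.kummerRigid_of_divisors`
works.  Print phrases the argument directly on "Kummer classes of RATIONAL functions", i.e. on the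
`π₁^rat(†𝒟^⊛)`-FIXED elements of `𝕄^⊛_∞κ(†𝒟^⊚)` (the elements lying in the function field `L_C` itself).  This file
gives that phrasing: the SAME conclusion from the SAME engine with the laws stated on the fixed ∞κ-coric
functions — so the derivation needs NO identification `𝕄^⊛_κ = (𝕄^⊛_∞κ)^{π₁^rat}` (one FACT binder fewer for the
layer certificate; under F-2571 the two law sets coincide verbatim).

## What is proved (theorems only; the printed inputs are EXPLICIT HYPOTHESES, no definition, no new fact)

* `NFBridgeRecon.existsUniqueCoricStructure_infκPair_of_fixedDivisors` — `ExistsUniqueCoricStructure π₁^rat 𝕄^⊛_∞κ(†𝒟^⊚)`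
  from (a) Kummer naturality `hnat`, (b′) divisor transport `hord` and Rmk 3.1.7 (i)/(ii) `hpole`/`hex` read on
  the `π₁^rat`-FIXED ∞κ-coric functions (exactly parallel to p424116's `…_infκxPair_of_divisors` for the ∞κ×-pair);
* consistency: under F-2571 the `𝕄^⊛_κ`-phrased laws of p424116 and the fixed-phrased ones coincide, so the
  statement "F-2571 + `𝕄^⊛_κ`-laws ⊢ `ExistsUniqueCoricStructure`" IS p424116's theorem (not restated — gate dedup).

PROOF-ONLY companion; nothing of abc-iut-w4-d056's file is modified.  typed ≠ proved; laws (a)/(b′)/Rmk 3.1.7 at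
the genuine Kummer map remain GAP-LEDGER G-w4d056-2.
-/

namespace Literature.IUT.HodgeTheaters

open ProfiniteGrp ProfiniteGrp.ProfiniteCompletion
open Literature.AnabelianGeometry.EtaleTheta Literature.AnabelianGeometry.EtaleTheta.ZHatLevel

universe u

namespace NFBridgeRecon

variable (N : NFBridgeRecon.{u})

/-- **Ex. 5.1 (v) for the model ∞κ-pair, divisor laws on the FIXED ∞κ-coric functions** ("Kummer classes of
rational functions", p. 127 l. 76 – p. 128 l. 2): given a Kummer realisation `κ` of
`π₁^rat(†𝒟^⊛) ↷ 𝕄^⊛_∞κ(†𝒟^⊚)` in a container with `Ẑ^×`-action satisfying (a) naturality `hnat`, orders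
`ord x : K^rat → ℤ` such that (b′) for `π₁^rat`-fixed ∞κ-coric `f, f′` with `κ(f′) = u • κ(f)` one has
`u(η(ord_x f)) = η(ord_x f′)` ([AbsTopIII] Prop. 1.6 (iii)), and Rmk 3.1.7 (i)/(ii): a fixed ∞κ-coric function has
at most one pole (`hpole`), some fixed ∞κ-coric function has two distinct zeroes (`hex`) — THEN
`ExistsUniqueCoricStructure π₁^rat 𝕄^⊛_∞κ(†𝒟^⊚)`.  PROVED (engine: abc-iut-w4-d056's
`existsUniqueCoricStructure_of_divisors` at `N := ⊤`); no `MκIsInvariants` input.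
([IUTchI] Ex 5.1 (v) p.128) [claim: Mochizuki2012, status: disputed] -/
theorem existsUniqueCoricStructure_infκPair_of_fixedDivisors {H : Type u} [CommGroup H]
    [MulAction N.piRat H] [MulAction (MulAut (completion (GrpCat.of (Multiplicative ℤ)))) H]
    (κ : N.infκPair.KummerRealization H)
    (hnat : ∀ e : CoricPair.Iso N.infκPair N.infκPair,
      ∃ u : MulAut (completion (GrpCat.of (Multiplicative ℤ))),
        ∀ x : N.infκPair.carrier, κ.toFun (e.toEquiv x) = u • κ.toFun x)
    {X : Type*} (ord : X → N.Krat → ℤ)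
    (hord : ∀ (u : MulAut (completion (GrpCat.of (Multiplicative ℤ)))) (f f' : N.infκPair.carrier),
      (∀ g : N.piRat, g • (f : N.Krat) = f) → (∀ g : N.piRat, g • (f' : N.Krat) = f') →
      κ.toFun f' = u • κ.toFun f → ∀ x : X, u (eta (ord x f)) = eta (ord x f'))
    (hpole : ∀ f' ∈ N.Minfκ, (∀ g : N.piRat, g • f' = f') →
      ∀ x₁ x₂ : X, x₁ ≠ x₂ → ¬ (ord x₁ f' < 0 ∧ ord x₂ f' < 0))
    (hex : ∃ f ∈ N.Minfκ, (∀ g : N.piRat, g • f = f) ∧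
      ∃ x₁ x₂ : X, x₁ ≠ x₂ ∧ 0 < ord x₁ f ∧ 0 < ord x₂ f) :
    ExistsUniqueCoricStructure N.piRat N.infκPair := by
  have hfix : ∀ f : N.infκPair.carrier, f ∈ N.infκPair.fixedSub ⊤ ↔ ∀ g : N.piRat, g • (f : N.Krat) = f := by
    intro f
    rw [CoricPair.mem_fixedSub_iff]
    constructor
    · intro h g
      exact congrArg (fun y : N.infκPair.carrier => (y : N.Krat)) (h g trivial)
    · intro h g _
      exact Subtype.ext (h g)
  refine existsUniqueCoricStructure_of_divisors κ ⊤ hnat (fun x (f : N.infκPair.carrier) => ord x (f : N.Krat))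
    ?_ ?_ ?_
  · intro u f f' hf hf' h x
    exact hord u f f' ((hfix f).mp hf) ((hfix f').mp hf') h x
  · intro f' hf' x₁ x₂ hx
    exact hpole _ f'.2 ((hfix f').mp hf') x₁ x₂ hx
  · obtain ⟨f, hf, hfixf, x₁, x₂, hx, h₁, h₂⟩ := hex
    exact ⟨⟨f, hf⟩, (hfix _).mpr hfixf, x₁, x₂, hx, h₁, h₂⟩

end NFBridgeRecon

end Literature.IUT.HodgeTheaters
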